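import Literature.NumberTheory.EllipticCurves.NeronComponentIndexProofs
import HarnessLib

/-!
# Points with singular reduction: transport, sums, existence (tools for `c_v = 2, 3, 4`)

Third file of the series on the local index `c_v = [E(K_v) : E₀(K_v)]`
(`NeronComponentIndex.lean`, `NeronComponentDataAssembly.lean`, `NeronComponentIndexProofs.lean`):
elementary tools, over a discrete valuation ring `R` with fraction field `K`, for the Kodaira
types whose index is `> 1` (Silverman, *ATAEC*, IV.9.4, Steps 4–9). Everything is about
`K`-points of an equation `I` with coefficients in `R` whose reduction has its singular point at
`(0, 0)` (`a₃, a₄, a₆ ∈ 𝔪`), and the subgroup `E₀(K)` in the form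
`WeierstrassCurve.HasNonsingularReduction` / `nonsingularReductionSubgroup` of
`ReductionHomomorphism.lean`.

* **Transport** (`hasNonsingularReduction_pointEquiv_iff`,
  `index_nonsingularReductionSubgroup_smul`): an `R`-change of variables `D` induces
  `I(K) ≃+ (D • I)(K)` preserving `E₀(K)`, so the index `[E(K) : E₀(K)]` may be computed on any
  `R`-model (Silverman, *AEC*, VII.1.3).
* **Bad points** (`exists_eq_some_of_not_hasNonsingularReduction`,
  `not_hasNonsingularReduction_some`): a point outside `E₀(K)` is an integral point
  `(x, y) ∈ 𝔪 × 𝔪`, and conversely.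
* **Sums of bad points** (`hasNonsingularReduction_add_of_slope`): if for two bad points the
  quantities `N = x₁² + x₁x₂ + x₂² + a₂(x₁ + x₂) + a₄ − a₁y₂` and `D = y₁ + y₂ + a₁x₁ + a₃` of the
  chord identity `(y₁ − y₂) D = (x₁ − x₂) N` (`Y_sub_mul_eq_X_sub_mul`) satisfy `N = πᵉ·unit`,
  `πᵉ ∣ D`, and `a₁, a₂ ∈ 𝔪`, then `P₁ + P₂ ∈ E₀(K)`: the slope is `λ = N/D` (chord or tangent
  alike), so either `λ ∈ Rˣ` and `x₃ = λ² + a₁λ − a₂ − x₁ − x₂` is a unit, whence `P₁ + P₂`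
  reduces to a point `≠ (0, 0)`, i.e. a nonsingular one; or `v(λ) < 0` and `P₁ + P₂` reduces to
  `𝒪` (`one_lt_v_addX_of_one_lt_v_slope`). This is the computation behind "the non-identity
  components of multiplicity one form a torsor" for types `III`, `III*` (`e = 1, 3`).
* **Existence** (`exists_root_of_henselian`): over a Henselian `R`, `πt³ + ct² + δt + ε`
  (`c ∈ 𝔪`, `δ ∈ Rˣ`) has a root — the bad point `(πt, 0)` of type `III` and `(π²t, 0)` of
  type `III*`.
* **Index two** (`index_eq_two_of_forall_add_mem`): a subgroup missing some element, such that the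
  sum of any two non-members is a member, has index `2`.

## References

* J. H. Silverman, *Advanced Topics in the Arithmetic of Elliptic Curves*, GTM 151, Springer
  1994, IV.9.4 Steps 4 and 9 and their proofs (PDF pp. 344–350). [SilvermanATAEC1994]
* J. H. Silverman, *The Arithmetic of Elliptic Curves*, 2nd ed., GTM 106, Springer 2009,
  VII.1.3 and VII.2.1. [SilvermanAEC2009]
-/

noncomputable section

open scoped Classical

open IsLocalRing

namespace Literature.NumberTheory.EllipticCurves

namespace LocalIndex

variable {R : Type*} [CommRing R] [IsDomain R] [IsDiscreteValuationRing R]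
  {K : Type*} [Field K] [Algebra R K] [IsFractionRing R K]

/-! ### Transport of `E₀(K)` along an `R`-change of variables -/

omit [IsDomain R] [IsDiscreteValuationRing R] [IsFractionRing R K] in
/-- Base change commutes with changes of variables: `D_K • I_K = (D • I)_K` (Mathlib's
`map_variableChange`, restated with `baseChange` on both sides so that it can index
`Affine.Point.congrEquiv`). [folklore] -/
theorem baseChange_smul_eq (I : WeierstrassCurve R) (D : WeierstrassCurve.VariableChange R) :
    D.map (algebraMap R K) • I.baseChange K = (D • I).baseChange K :=
  WeierstrassCurve.map_variableChange I D (algebraMap R K)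

omit [IsDomain R] [IsDiscreteValuationRing R] [IsFractionRing R K] in
/-- The isomorphism of point groups `I(K) ≃+ (D • I)(K)` induced by a change of variables `D`
over `R` — `VariableChange.pointEquiv` over `K` landed on `(D • I) ⊗ K` via
`Affine.Point.congrEquiv` and Mathlib's `map_variableChange` (Silverman, *AEC*, VII.1.3) — on an
affine point: the substitution `(x, y) ↦ (u⁻²(x − r), u⁻³(y − s(x − r) − t))`. [folklore] -/
theorem congrEquiv_pointEquiv_some (I : WeierstrassCurve R) (D : WeierstrassCurve.VariableChange R)
    {x y : K} (h : (I.baseChange K).toAffine.Nonsingular x y) :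
    ∃ h', WeierstrassCurve.Affine.Point.congrEquiv
        (baseChange_smul_eq I D)
        (WeierstrassCurve.VariableChange.pointEquiv (I.baseChange K) (D.map (algebraMap R K))
          (.some x y h)) =
      .some ((D.map (algebraMap R K)).toX x) ((D.map (algebraMap R K)).toY x y) h' := by
  refine ⟨?_, ?_⟩
  · rw [← baseChange_smul_eq I D]
    exact (WeierstrassCurve.VariableChange.nonsingular_iff _ _ x y).mpr h
  · rw [WeierstrassCurve.VariableChange.pointEquiv_some,
      WeierstrassCurve.Affine.Point.congrEquiv_some]

/-- `HasNonsingularReduction` of an affine point depends only on its coordinates. [folklore] -/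
theorem hasNonsingularReduction_some_iff_of_eq (I : WeierstrassCurve R) {x y : K}
    (h : (I.baseChange K).toAffine.Nonsingular x y) {a b : R} (hx : x = algebraMap R K a)
    (hy : y = algebraMap R K b) :
    I.HasNonsingularReduction (.some x y h) ↔
      (I.map (residue R)).toAffine.Nonsingular (residue R a) (residue R b) := by
  subst hx hy
  exact WeierstrassCurve.hasNonsingularReduction_some_algebraMap_iff
    (IsFractionRing.injective R K) h

/-- **`E₀(K)` is preserved by `R`-changes of variables**: `P ∈ E₀(I)` iff its image lies in
`E₀(D • I)` (reduction commutes with `R`-isomorphisms; Silverman, *AEC*, VII.1.3(b) and VII.2).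
[cite: SilvermanAEC2009, VII.1 Prop. 1.3(b)] -/
theorem hasNonsingularReduction_pointEquiv_iff (I : WeierstrassCurve R)
    (D : WeierstrassCurve.VariableChange R) (P : (I.baseChange K).toAffine.Point) :
    (D • I).HasNonsingularReduction (WeierstrassCurve.Affine.Point.congrEquiv
        (baseChange_smul_eq I D)
        (WeierstrassCurve.VariableChange.pointEquiv (I.baseChange K) (D.map (algebraMap R K)) P)) ↔
      I.HasNonsingularReduction P := by
  have hv := integers_valuationRing_valuation R K
  rcases point_cases hv P with rfl | ⟨x, y, h, rfl, hx⟩ | ⟨a, b, h, rfl⟩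
  · rw [map_zero, map_zero]; exact iff_of_true trivial trivial
  · obtain ⟨h', e⟩ := congrEquiv_pointEquiv_some I D h
    rw [e]
    refine iff_of_true (Or.inl ((not_mem_range_iff hv).mpr ?_))
      (Or.inl ((not_mem_range_iff hv).mpr hx))
    -- `|u⁻²(x − r)| = |x| > 1`
    rw [WeierstrassCurve.VariableChange.toX_def, Valuation.map_mul, Valuation.map_pow]
    have hu : ValuationRing.valuation R K (((D.map (algebraMap R K)).u⁻¹ : Kˣ) : K) = 1 := by
      rw [WeierstrassCurve.VariableChange.map_u, Units.coe_map_inv, MonoidHom.coe_coe]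
      exact hv.isUnit_iff_valuation_eq_one.mp (D.u⁻¹).isUnit
    have hr : ValuationRing.valuation R K ((D.map (algebraMap R K)).r) <
        ValuationRing.valuation R K x :=
      lt_of_le_of_lt (hv.map_le_one _) hx
    rw [hu, one_pow, one_mul, Valuation.map_sub_eq_of_lt_left _ hr]
    exact hx
  · obtain ⟨h', e⟩ := congrEquiv_pointEquiv_some I D h
    rw [e, hasNonsingularReduction_some_iff_of_eq (D • I) h'
        (WeierstrassCurve.VariableChange.map_toX_ringHom (algebraMap R K) D a).symm
        (map_toY_ringHom (algebraMap R K) D a b).symm,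
      WeierstrassCurve.hasNonsingularReduction_some_algebraMap_iff (IsFractionRing.injective R K),
      ← WeierstrassCurve.map_variableChange, WeierstrassCurve.VariableChange.map_toX_ringHom,
      map_toY_ringHom, WeierstrassCurve.VariableChange.nonsingular_iff]

/-- **The index `[E(K) : E₀(K)]` is the same for all `R`-models** `D • I` of `I`.
[cite: SilvermanAEC2009, VII.1 Prop. 1.3(b)] -/
theorem index_nonsingularReductionSubgroup_smul (I : WeierstrassCurve R)
    (D : WeierstrassCurve.VariableChange R) :
    ((D • I).nonsingularReductionSubgroup (integers_valuationRing_valuation R K)).index =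
      (I.nonsingularReductionSubgroup (integers_valuationRing_valuation R K)).index := by
  set ψ : (I.baseChange K).toAffine.Point ≃+ ((D • I).baseChange K).toAffine.Point :=
    (WeierstrassCurve.VariableChange.pointEquiv (I.baseChange K) (D.map (algebraMap R K))).trans
      (WeierstrassCurve.Affine.Point.congrEquiv
        (baseChange_smul_eq I D)) with hψ
  have hcomap : I.nonsingularReductionSubgroup (integers_valuationRing_valuation R K) =
      ((D • I).nonsingularReductionSubgroup (integers_valuationRing_valuation R K)).comap
        ψ.toAddMonoidHom := by
    ext P
    simp only [AddSubgroup.mem_comap, WeierstrassCurve.mem_nonsingularReductionSubgroup_iff]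
    exact (hasNonsingularReduction_pointEquiv_iff I D P).symm
  rw [hcomap, AddSubgroup.index_comap_of_surjective _ ψ.surjective]

/-! ### Bad points are integral points in `𝔪 × 𝔪` -/

/-- If `a₃, a₄, a₆ ∈ 𝔪`, a point of `I(K)` *without* nonsingular reduction is an integral point
`(x, y)` with `x, y ∈ 𝔪` (it reduces to the singular point `(0, 0)`). [folklore] -/
theorem exists_eq_some_of_not_hasNonsingularReduction (I : WeierstrassCurve R)
    (h3 : I.a₃ ∈ maximalIdeal R) (h4 : I.a₄ ∈ maximalIdeal R) (h6 : I.a₆ ∈ maximalIdeal R)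
    {P : (I.baseChange K).toAffine.Point} (hP : ¬ I.HasNonsingularReduction P) :
    ∃ (x y : R) (h : (I.baseChange K).toAffine.Nonsingular (algebraMap R K x) (algebraMap R K y)),
      P = .some _ _ h ∧ x ∈ maximalIdeal R ∧ y ∈ maximalIdeal R := by
  have hv := integers_valuationRing_valuation R K
  rcases point_cases hv P with rfl | ⟨x, y, h, rfl, hx⟩ | ⟨a, b, h, rfl⟩
  · exact (hP trivial).elim
  · exact (hP (Or.inl ((not_mem_range_iff hv).mpr hx))).elim
  · rw [WeierstrassCurve.hasNonsingularReduction_some_algebraMap_iff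
      (IsFractionRing.injective R K)] at hP
    have he : I.toAffine.Equation a b :=
      (WeierstrassCurve.Affine.map_equation _ (IsFractionRing.injective R K) a b).mp h.left
    exact ⟨a, b, h, rfl, mem_maximalIdeal_of_not_nonsingular h3 h4 h6 he hP⟩

/-- Conversely an integral point `(x, y) ∈ 𝔪 × 𝔪` reduces to `(0, 0)`, which is singular when
`a₃, a₄, a₆ ∈ 𝔪` (`nonsingular_zero`), so it is not in `E₀(K)`. [folklore] -/
theorem not_hasNonsingularReduction_some (I : WeierstrassCurve R)
    (h3 : I.a₃ ∈ maximalIdeal R) (h4 : I.a₄ ∈ maximalIdeal R)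
    {x y : R} (hx : x ∈ maximalIdeal R) (hy : y ∈ maximalIdeal R)
    (h : (I.baseChange K).toAffine.Nonsingular (algebraMap R K x) (algebraMap R K y)) :
    ¬ I.HasNonsingularReduction (.some _ _ h) := by
  rw [WeierstrassCurve.hasNonsingularReduction_some_algebraMap_iff (IsFractionRing.injective R K),
    (residue_eq_zero_iff _).mpr hx, (residue_eq_zero_iff _).mpr hy,
    WeierstrassCurve.Affine.nonsingular_zero]
  simp only [WeierstrassCurve.map_a₃, WeierstrassCurve.map_a₄, WeierstrassCurve.map_a₆,
    (residue_eq_zero_iff _).mpr h3, (residue_eq_zero_iff _).mpr h4, ne_eq, not_true_eq_false,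
    or_self, and_false, not_false_eq_true]

/-- An affine point whose `x`-coordinate is a unit of `R` has nonsingular reduction, when the
singular point of the reduction is `(0, 0)` (`a₃, a₄, a₆ ∈ 𝔪`). [folklore] -/
theorem hasNonsingularReduction_some_of_isUnit (I : WeierstrassCurve R)
    (h3 : I.a₃ ∈ maximalIdeal R) (h4 : I.a₄ ∈ maximalIdeal R) (h6 : I.a₆ ∈ maximalIdeal R)
    {a : R} (ha : IsUnit a) {x y : K} (h : (I.baseChange K).toAffine.Nonsingular x y)
    (hx : x = algebraMap R K a) : I.HasNonsingularReduction (.some _ _ h) := by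
  have hv := integers_valuationRing_valuation R K
  subst hx
  obtain ⟨b, hb⟩ := hv.exists_of_le_one (v_Y_le_one_of_v_X_le_one hv h.1 (hv.map_le_one a))
  rw [hasNonsingularReduction_some_iff_of_eq I h rfl hb.symm]
  by_contra hns
  have he' := h.left
  rw [← hb] at he'
  have he : I.toAffine.Equation a b :=
    (WeierstrassCurve.Affine.map_equation _ (IsFractionRing.injective R K) a b).mp he'
  exact (IsLocalRing.mem_maximalIdeal _).mp (mem_maximalIdeal_of_not_nonsingular h3 h4 h6 he hns).1
    ha

/-! ### The sum of two bad points -/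

/-- **The slope is `N/D`, chord and tangent alike.** For two points of a Weierstrass cubic over
a field with `P₁ + P₂ ≠ 𝒪`, the slope `λ` of the line through them (the tangent if `P₁ = P₂`)
satisfies `λ·(y₁ + y₂ + a₁x₁ + a₃) = x₁² + x₁x₂ + x₂² + a₂(x₁ + x₂) + a₄ − a₁y₂`
(chord: `(y₁ − y₂)(y₁ + y₂ + a₁x₁ + a₃) = (x₁ − x₂)(…)`, `Y_sub_mul_eq_X_sub_mul`; tangent:
Mathlib's `slope_of_Y_ne`, after `y₁ = y₂` by `Y_eq_of_Y_ne`). [folklore] -/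
theorem slope_mul_eq {F : Type*} [Field F] {W : WeierstrassCurve.Affine F} {x₁ x₂ y₁ y₂ : F}
    (h₁ : W.Equation x₁ y₁) (h₂ : W.Equation x₂ y₂) (hxy : ¬(x₁ = x₂ ∧ y₁ = W.negY x₂ y₂)) :
    W.slope x₁ x₂ y₁ y₂ * (y₁ + y₂ + W.a₁ * x₁ + W.a₃) =
      x₁ ^ 2 + x₁ * x₂ + x₂ ^ 2 + W.a₂ * (x₁ + x₂) + W.a₄ - W.a₁ * y₂ := by
  by_cases hx : x₁ = x₂
  · have hy : y₁ = y₂ := WeierstrassCurve.Affine.Y_eq_of_Y_ne h₁ h₂ hx fun h => hxy ⟨hx, h⟩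
    subst hx hy
    have hne : y₁ ≠ W.negY x₁ y₁ := fun h => hxy ⟨rfl, h⟩
    have hden : y₁ - W.negY x₁ y₁ = y₁ + y₁ + W.a₁ * x₁ + W.a₃ := by
      rw [WeierstrassCurve.Affine.negY]; ring
    rw [WeierstrassCurve.Affine.slope_of_Y_ne rfl hne, hden,
      div_mul_cancel₀ _ (hden ▸ sub_ne_zero.mpr hne)]
    ring
  · rw [WeierstrassCurve.Affine.slope_of_X_ne hx, div_mul_eq_mul_div,
      div_eq_iff (sub_ne_zero.mpr hx), WeierstrassCurve.Affine.Y_sub_mul_eq_X_sub_mul W h₁ h₂]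
    ring

/-- **Sum of two bad points.** Let `a₁, a₂, a₃, a₄, a₆ ∈ 𝔪` and let `P₁ = (x₁, y₁)`,
`P₂ = (x₂, y₂)` be integral points with `x₁, x₂ ∈ 𝔪` such that, for some `e`,
`N = x₁² + x₁x₂ + x₂² + a₂(x₁ + x₂) + a₄ − a₁y₂ = πᵉ u` with `u ∈ Rˣ` and `πᵉ ∣ D`,
`D = y₁ + y₂ + a₁x₁ + a₃`. Then `P₁ + P₂ ∈ E₀(K)`: unless `P₁ + P₂ = 𝒪`, the slope is
`λ = N/D` (`slope_mul_eq`), so `λ·(D/πᵉ) = u`; if `D/πᵉ` is a unit then `λ ∈ Rˣ` and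
`x(P₁ + P₂) = λ² + a₁λ − a₂ − x₁ − x₂` is a unit, so `P₁ + P₂` does not reduce to `(0, 0)`;
otherwise `v(λ) < 0` and `P₁ + P₂` reduces to `𝒪` (`one_lt_v_addX_of_one_lt_v_slope`). This is
the computation behind `c = 2` in Silverman, *ATAEC*, IV.9.4 Steps 4 and 9. [folklore] -/
theorem hasNonsingularReduction_add_of_slope (I : WeierstrassCurve R) {ϖ : R}
    (hϖ : Irreducible ϖ) (e : ℕ) (h1 : I.a₁ ∈ maximalIdeal R) (h2 : I.a₂ ∈ maximalIdeal R)
    (h3 : I.a₃ ∈ maximalIdeal R) (h4 : I.a₄ ∈ maximalIdeal R) (h6 : I.a₆ ∈ maximalIdeal R)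
    {x₁ y₁ x₂ y₂ : R} (hx₁ : x₁ ∈ maximalIdeal R) (hx₂ : x₂ ∈ maximalIdeal R) {u : R}
    (hu : IsUnit u)
    (hN : x₁ ^ 2 + x₁ * x₂ + x₂ ^ 2 + I.a₂ * (x₁ + x₂) + I.a₄ - I.a₁ * y₂ = ϖ ^ e * u)
    (hD : ϖ ^ e ∣ y₁ + y₂ + I.a₁ * x₁ + I.a₃)
    (h₁ : (I.baseChange K).toAffine.Nonsingular (algebraMap R K x₁) (algebraMap R K y₁))
    (h₂ : (I.baseChange K).toAffine.Nonsingular (algebraMap R K x₂) (algebraMap R K y₂)) :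
    I.HasNonsingularReduction
      (WeierstrassCurve.Affine.Point.some _ _ h₁ + WeierstrassCurve.Affine.Point.some _ _ h₂) := by
  have hv := integers_valuationRing_valuation R K
  have hinj := IsFractionRing.injective R K
  by_cases hxy : algebraMap R K x₁ = algebraMap R K x₂ ∧
      algebraMap R K y₁ = (I.baseChange K).toAffine.negY (algebraMap R K x₂) (algebraMap R K y₂)
  · rw [WeierstrassCurve.Affine.Point.add_of_Y_eq hxy.1 hxy.2]; trivial
  rw [WeierstrassCurve.Affine.Point.add_some hxy]
  obtain ⟨d, hd⟩ := hD
  -- the slope `L` satisfies `L * D = N`, hence `L * d = u`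
  have hLD := slope_mul_eq h₁.1 h₂.1 hxy
  have e1 : algebraMap R K y₁ + algebraMap R K y₂ +
      (I.baseChange K).toAffine.a₁ * algebraMap R K x₁ + (I.baseChange K).toAffine.a₃ =
        algebraMap R K (y₁ + y₂ + I.a₁ * x₁ + I.a₃) := by
    simp [WeierstrassCurve.baseChange]
  have e2 : algebraMap R K x₁ ^ 2 + algebraMap R K x₁ * algebraMap R K x₂ +
      algebraMap R K x₂ ^ 2 +
      (I.baseChange K).toAffine.a₂ * (algebraMap R K x₁ + algebraMap R K x₂) +
      (I.baseChange K).toAffine.a₄ - (I.baseChange K).toAffine.a₁ * algebraMap R K y₂ =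
        algebraMap R K (x₁ ^ 2 + x₁ * x₂ + x₂ ^ 2 + I.a₂ * (x₁ + x₂) + I.a₄ - I.a₁ * y₂) := by
    simp [WeierstrassCurve.baseChange]
  rw [e1, e2, hd, hN, map_mul, map_mul, ← mul_assoc, mul_comm _ (algebraMap R K (ϖ ^ e)),
    mul_assoc] at hLD
  have hϖ0 : algebraMap R K (ϖ ^ e) ≠ 0 :=
    (map_ne_zero_iff _ hinj).mpr (pow_ne_zero _ hϖ.ne_zero)
  have hLd := mul_left_cancel₀ hϖ0 hLD
  by_cases hdu : IsUnit d
  · -- `λ = u/d ∈ Rˣ`: the sum is an integral point with unit `x`-coordinate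
    set ℓ : R := u * ↑hdu.unit⁻¹ with hℓ
    have hd0 : algebraMap R K d ≠ 0 := (map_ne_zero_iff _ hinj).mpr hdu.ne_zero
    have hLeq : (I.baseChange K).toAffine.slope (algebraMap R K x₁) (algebraMap R K x₂)
        (algebraMap R K y₁) (algebraMap R K y₂) = algebraMap R K ℓ := by
      rw [← mul_left_inj' hd0, hLd, hℓ, ← map_mul, mul_assoc, IsUnit.val_inv_mul, mul_one]
    have hℓu : IsUnit ℓ := hu.mul (Units.isUnit _)
    have hX : (I.baseChange K).toAffine.addX (algebraMap R K x₁) (algebraMap R K x₂)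
        ((I.baseChange K).toAffine.slope (algebraMap R K x₁) (algebraMap R K x₂)
          (algebraMap R K y₁) (algebraMap R K y₂)) =
        algebraMap R K (ℓ ^ 2 + I.a₁ * ℓ - I.a₂ - x₁ - x₂) := by
      rw [WeierstrassCurve.Affine.addX, hLeq]; simp [WeierstrassCurve.baseChange]
    have hunit : IsUnit (ℓ ^ 2 + I.a₁ * ℓ - I.a₂ - x₁ - x₂) := by
      refine IsLocalRing.notMem_maximalIdeal.mp fun hm => ?_
      have hsq : ℓ ^ 2 ∈ maximalIdeal R := by
        have e3 : ℓ ^ 2 = (ℓ ^ 2 + I.a₁ * ℓ - I.a₂ - x₁ - x₂) - I.a₁ * ℓ + I.a₂ + x₁ + x₂ := by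
          ring
        rw [e3]
        exact Ideal.add_mem _ (Ideal.add_mem _ (Ideal.add_mem _ (Ideal.sub_mem _ hm
          (Ideal.mul_mem_right _ _ h1)) h2) hx₁) hx₂
      exact IsLocalRing.notMem_maximalIdeal.mpr hℓu
        (Ideal.IsPrime.mem_of_pow_mem inferInstance 2 hsq)
    exact hasNonsingularReduction_some_of_isUnit I h3 h4 h6 hunit _ hX
  · -- `v(λ) < 0`: the sum reduces to `𝒪`
    have hdlt : ValuationRing.valuation R K (algebraMap R K d) < 1 :=
      (v_algebraMap_lt_one_iff hv d).mpr ((residue_eq_zero_iff _).mpr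
        ((IsLocalRing.mem_maximalIdeal _).mpr hdu))
    have hLv : 1 < ValuationRing.valuation R K ((I.baseChange K).toAffine.slope
        (algebraMap R K x₁) (algebraMap R K x₂) (algebraMap R K y₁) (algebraMap R K y₂)) := by
      by_contra hle
      rw [not_lt] at hle
      have h1' := mul_le_mul' hle (le_refl (ValuationRing.valuation R K (algebraMap R K d)))
      rw [one_mul, ← Valuation.map_mul, hLd, (hv.isUnit_iff_valuation_eq_one).mp hu] at h1'
      exact (lt_irrefl _) (h1'.trans_lt hdlt)
    exact Or.inl ((not_mem_range_iff hv).mpr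
      (one_lt_v_addX_of_one_lt_v_slope hv (hv.map_le_one x₁) (hv.map_le_one x₂) hLv))

/-! ### Existence of a bad point over a Henselian ring -/

/-- Over a Henselian local ring, `πt³ + ct² + δt + ε` with `π, c ∈ 𝔪` and `δ` a unit has a root
(`t₀ = −ε/δ` is an approximate root with unit derivative; non-monic Hensel,
`HenselianLocalRing.exists_isRoot_of_isUnit_derivative`). [folklore] -/
theorem exists_root_of_henselian {S : Type*} [CommRing S] [HenselianLocalRing S] {ϖ c δ ε : S}
    (hϖ : ϖ ∈ maximalIdeal S) (hc : c ∈ maximalIdeal S) (hδ : IsUnit δ) :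
    ∃ t : S, ϖ * t ^ 3 + c * t ^ 2 + δ * t + ε = 0 := by
  set g : Polynomial S := Polynomial.C ϖ * Polynomial.X ^ 3 + Polynomial.C c * Polynomial.X ^ 2 +
    Polynomial.C δ * Polynomial.X + Polynomial.C ε with hg
  set t₀ : S := -(ε * ↑hδ.unit⁻¹) with ht₀
  have hev : ∀ t, g.eval t = ϖ * t ^ 3 + c * t ^ 2 + δ * t + ε := by
    intro t; simp only [hg, Polynomial.eval_add, Polynomial.eval_mul, Polynomial.eval_C,
      Polynomial.eval_pow, Polynomial.eval_X]
  have hev' : ∀ t, g.derivative.eval t = 3 * ϖ * t ^ 2 + 2 * c * t + δ := by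
    intro t
    simp [hg]
    ring
  have h₁ : g.eval t₀ ∈ maximalIdeal S := by
    rw [hev]
    have e1 : δ * t₀ + ε = 0 := by
      rw [ht₀, mul_neg, ← mul_assoc, mul_comm δ ε, mul_assoc, IsUnit.mul_val_inv, mul_one,
        neg_add_cancel]
    have e2 : ϖ * t₀ ^ 3 + c * t₀ ^ 2 + δ * t₀ + ε = ϖ * t₀ ^ 3 + c * t₀ ^ 2 + (δ * t₀ + ε) := by
      ring
    rw [e2, e1, add_zero]
    exact Ideal.add_mem _ (Ideal.mul_mem_right _ _ hϖ) (Ideal.mul_mem_right _ _ hc)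
  have h₂ : IsUnit (g.derivative.eval t₀) := by
    rw [hev']
    have e3 : 3 * ϖ * t₀ ^ 2 + 2 * c * t₀ + δ = δ + (3 * t₀ ^ 2 * ϖ + 2 * t₀ * c) := by ring
    rw [e3]
    refine IsLocalRing.notMem_maximalIdeal.mp fun hm => IsLocalRing.notMem_maximalIdeal.mpr hδ ?_
    have hm' : 3 * t₀ ^ 2 * ϖ + 2 * t₀ * c ∈ maximalIdeal S :=
      Ideal.add_mem _ (Ideal.mul_mem_left _ _ hϖ) (Ideal.mul_mem_left _ _ hc)
    simpa using Ideal.sub_mem _ hm hm'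
  obtain ⟨t, ht, -⟩ := HenselianLocalRing.exists_isRoot_of_isUnit_derivative g t₀ h₁ h₂
  exact ⟨t, by rw [← hev]; exact ht⟩

/-! ### Index two -/

omit [IsDomain R] [IsDiscreteValuationRing R] in
/-- A subgroup `H` of an abelian group missing an element `P₀`, and such that the sum of any two
elements outside `H` lies in `H`, has index `2`. [folklore] -/
theorem index_eq_two_of_forall_add_mem {G : Type*} [AddCommGroup G] (H : AddSubgroup G) {P₀ : G}
    (hP₀ : P₀ ∉ H) (hadd : ∀ P Q : G, P ∉ H → Q ∉ H → P + Q ∈ H) : H.index = 2 := by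
  rw [AddSubgroup.index_eq_two_iff]
  refine ⟨P₀, fun b => ?_⟩
  by_cases hb : b ∈ H
  · refine Or.inr ⟨hb, fun h => hP₀ ?_⟩
    simpa using H.sub_mem h hb
  · exact Or.inl ⟨hadd b P₀ hb hP₀, hb⟩

end LocalIndex

end Literature.NumberTheory.EllipticCurves

end
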